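import Summits.AnomalousDissipation.AnomalousDissipation.Theses.TaylorCertificates

/-!
# Route TaylorCertificates — the support `SteadyClassicalBridge`, dependency-light proof

A second, self-contained proof of the route declaration
`Summit.AnomalousDissipation.AnomalousDissipation.Theses.TaylorCertificates.SteadyClassicalBridge`
(item stmt-AnomalousDissipation-14884), importing nothing beyond the route file itself.

The first proof (`Theorems/TaylorCertificatesSteadyClassicalBridge.lean`, `steadyClassicalBridge_proof`)
is two lines over the generic torus lemmas of
`Theorems/KolmogorovFloorEnsembleCeiling/Negative/PlanarSteady.lean`; this twin unfolds those two lemmas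
(`divFree_meanZero_of_rep`, `residual_orthogonal_of_steadyWeak`) at `d = Fin 3` so that the closing
theorem lives in a module whose import closure is that of the route file alone (the nested `Negative/`
module kept the first file unbuilt on the hub, so the item could not be closed against it).

Mathematics (Temam 1979, steady weak solutions; Foias–Manley–Rosa–Temam 2001): if `u ∈ H` is an
`H`-steady weak solution of `NS_ν(f)` (`Torus.IsSteadyWeakSolution`: `(f,w) + ν(u,Δw) + ∫⟪Dw·u,u⟫ = 0`
on smooth divergence-free mean-zero `w`), `f` is smooth and `v` is a smooth a.e.-representative of `u`:
* `v` is weakly divergence free (transport of `isWeaklyDivFree_of_mem_energySpace` along `u = v` a.e.),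
  hence classically divergence free (`isDivFree_of_sum_mul_mFourierCoeff_eq_zero` fed by
  `IsWeaklyDivFree.sum_mul_mFourierCoeff_eq_zero`), and mean zero (`integral_eq_zero_of_mem_energySpace`);
* rewriting the generator pairing on `v` and moving every derivative back onto `v` — Green's second
  identity `integral_inner_laplacian_comm` and the antisymmetry of the trilinear form
  `integral_inner_convect_eq_neg` — gives `∫⟪νΔv − (v·∇)v + f, w⟫ = (f,w) + ν(v,Δw) + ∫⟪Dw·v,v⟫ = 0`.
-/

namespace Summit.AnomalousDissipation.AnomalousDissipation.Theorems

-- the mandated namespace `Summit.<Summit>.<Problem>.Theorems` repeats `AnomalousDissipation` (single-problem summit)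
set_option linter.dupNamespace false

open MeasureTheory
open Literature.Analysis.FunctionSpaces Literature.Analysis.FunctionSpaces.Torus Literature.Analysis.FluidPDE
open Summit.AnomalousDissipation.AnomalousDissipation.Theses.TaylorCertificates

/-- **From the `H`-weak to the classical steady formulation**, dependency-light twin of
`steadyClassicalBridge_proof` (item stmt-AnomalousDissipation-14884). For every viscosity `ν`, smooth
force `f`, `H`-steady weak solution `u ∈ H` of `NS_ν(f)` and smooth `v` with `u = v` a.e.: `v` is
divergence free and mean zero, and `∫⟪ν • Δv − (v·∇)v + f, w⟫ = 0` for every smooth divergence-free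
mean-zero `w`. Proof: weak solenoidality and the zero mean of `H` transported along the a.e.-equality and
upgraded on the smooth representative; then the generator pairing rewritten on `v`, Green's second identity
and the antisymmetry of the trilinear form. -/
theorem steadyClassicalBridge_direct_proof :
    Summit.AnomalousDissipation.AnomalousDissipation.Theses.TaylorCertificates.SteadyClassicalBridge := by
  unfold SteadyClassicalBridge
  intro ν f v u hfs hU hv hUv
  -- (a) solenoidality and zero mean of the smooth representative
  have hwdf : IsWeaklyDivFree v := by
    intro θ hθ
    rw [← Torus.isWeaklyDivFree_of_mem_energySpace u.2 θ hθ]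
    refine integral_congr_ae ?_
    filter_upwards [hUv] with y hy
    rw [hy]
  have hvd : IsDivFree v :=
    isDivFree_of_sum_mul_mFourierCoeff_eq_zero hv fun k => hwdf.sum_mul_mFourierCoeff_eq_zero (hv.memLp 2) k
  have hvz : HasZeroMean v := by
    have h0 := Torus.integral_eq_zero_of_mem_energySpace u.2
    unfold HasZeroMean
    rw [← h0]
    exact integral_congr_ae hUv.symm
  refine ⟨hvd, hvz, fun w hw hdw hzw => ?_⟩
  -- (b) the generator pairing at `u`, rewritten on the representative `v`
  have h := hU w hw hdw hzw
  have h1 : (∫ x, inner ℝ (((u : Lp (EuclideanSpace ℝ (Fin 3)) 2 (volume : Measure (UnitAddTorus (Fin 3)))) : UnitAddTorus (Fin 3) → EuclideanSpace ℝ (Fin 3)) x)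
      (Torus.laplacian w x)) = ∫ x, inner ℝ (v x) (Torus.laplacian w x) := by
    refine integral_congr_ae ?_
    filter_upwards [hUv] with x hx
    rw [hx]
  have h2 : (∫ x, inner ℝ (Torus.fderiv w x
      (((u : Lp (EuclideanSpace ℝ (Fin 3)) 2 (volume : Measure (UnitAddTorus (Fin 3)))) : UnitAddTorus (Fin 3) → EuclideanSpace ℝ (Fin 3)) x))
      (((u : Lp (EuclideanSpace ℝ (Fin 3)) 2 (volume : Measure (UnitAddTorus (Fin 3)))) : UnitAddTorus (Fin 3) → EuclideanSpace ℝ (Fin 3)) x)) =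
      ∫ x, inner ℝ (Torus.fderiv w x (v x)) (v x) := by
    refine integral_congr_ae ?_
    filter_upwards [hUv] with x hx
    rw [hx]
  unfold Torus.nsGeneratorPairing Torus.inertialPairing at h
  rw [h1, h2] at h
  -- (c) all derivatives back onto `v`: `∫⟪νΔv − (v·∇)v + f, w⟫ = (f, w) + ν (v, Δw) + ∫⟪Dw·v, v⟫`
  have hlap : ∫ x, inner ℝ (v x) (Torus.laplacian w x) = ∫ x, inner ℝ (Torus.laplacian v x) (w x) :=
    (Torus.integral_inner_laplacian_comm hv hw).symm
  have hconv : ∫ x, inner ℝ (Torus.fderiv w x (v x)) (v x) = -∫ x, inner ℝ (Torus.convect v v x) (w x) := by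
    change ∫ x, inner ℝ (Torus.convect v w x) (v x) = _
    rw [Torus.integral_inner_convect_eq_neg hv hvd hw hv]
    congr 1
    exact integral_congr_ae (ae_of_all _ fun x => real_inner_comm _ _)
  have i1 : Integrable (fun x => inner ℝ (ν • Torus.laplacian v x) (w x)) volume := by
    have := ((hv.laplacian.inner hw).integrable).const_mul ν
    refine this.congr (ae_of_all _ fun x => ?_)
    simp [inner_smul_left]
  have i2 : Integrable (fun x => inner ℝ (Torus.convect v v x) (w x)) volume := ((hv.convect hv).inner hw).integrable
  have i3 : Integrable (fun x => inner ℝ (f x) (w x)) volume := (hfs.inner hw).integrable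
  have key : ∫ x, inner ℝ (ν • Torus.laplacian v x - Torus.convect v v x + f x) (w x) =
      (∫ x, inner ℝ (f x) (w x)) + ν * (∫ x, inner ℝ (v x) (Torus.laplacian w x))
        + ∫ x, inner ℝ (Torus.fderiv w x (v x)) (v x) := by
    simp_rw [inner_add_left, inner_sub_left]
    rw [integral_add ?_ i3, integral_sub i1 i2, hlap, hconv]
    · have : ∫ x, inner ℝ (ν • Torus.laplacian v x) (w x) = ν * ∫ x, inner ℝ (Torus.laplacian v x) (w x) := by
        rw [← integral_const_mul]
        refine integral_congr_ae (ae_of_all _ fun x => ?_)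
        simp [inner_smul_left]
      rw [this]
      ring
    · exact i1.sub i2
  rw [key]
  exact h

end Summit.AnomalousDissipation.AnomalousDissipation.Theorems
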